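import Summits.Langlands.Langlands.Theses.AbelianSurfaceSerre
import Literature.NumberTheory.DiophantineGeometry.BcgpSerreWreathFixedSimilitudeImprimitiveSurfaces
import HarnessLib

/-!
# Crux `AbelianSurfaceSerre.QuadraticImprimitiveSurfaces` (K2, stmt-Langlands-17766) from its two
# layer-2 route items `SerreGSp4WreathFixed` (stmt-Langlands-18072) and `WreathReductionFixed`
# (stmt-Langlands-18078)

Line `Sketch` of the crux, cycle 3 (continuation lead c2): the two registered stubs of the skeleton
`Lines/Sketch.lean` v3 were PROMOTED to route items (route rev 4): `SerreGSp4WreathFixed` — Serre's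
conjecture for `GSp₄/ℚ` in regular ordinary weight at the wreath residues, similitude of the lift
pinned (OPEN) — and `WreathReductionFixed` — the corrected printed reduction "that ⟹ K2" (BCGP 2025
Lemma 10.4.1, type **B**[C₂], + Thm 10.2.1 + Faltings + descent), definitionally the accepted named
fact `Literature.NumberTheory.DiophantineGeometry.bcgp_serreWreathFixedSimilitude_implies_quadraticImprimitiveSurfacesModular`.
This file is the in-tree BRIDGE (everything proved, no `sorry`):

* `quadraticImprimitiveSurfaces_of_wreathItems` — `K2 ⇐ 18072 + 18078` (modus ponens; registered
  sub-goal of the line); once the gate appends `SerreGSp4WreathFixed_holds` and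
  `WreathReductionFixed_holds` to the route file, `quadraticImprimitiveSurfaces_of_wreathItems
  SerreGSp4WreathFixed_holds WreathReductionFixed_holds` closes K2;
* calibrations `wreathReductionFixed_iff_imp` (18078 unfolds to `18072 → K2`),
  `wreathReductionFixed_iff_namedFact` (18078 ≡ the named fact, `Iff.rfl`: proving either proves the
  other), `wreathReductionFixed_of_serreWreath` (18078 from the older, formally stronger `∃ μ` fact via
  the accepted audit theorem).

[cite: BoxerCalegariGeePilloni2025, Lemma 10.4.1 proof p. 146 (type B[C₂]), Rem. 10.4.2, Thm 10.2.1, Rem. 10.2.2]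
-/

set_option linter.dupNamespace false

namespace Summit.Langlands.Langlands.Cruxes.QuadraticImprimitiveSurfaces.Sketch

/-- **K2 from its two layer-2 items (modus ponens).**  `WreathReductionFixed` is by definition
`SerreGSp4WreathFixed → QuadraticImprimitiveSurfaces`. (Registered sub-goal of line `Sketch`; the
composition `QuadraticImprimitiveSurfaces_of` of `Lines/Sketch.lean` v4 is this theorem applied to
the two stubs.) [cite: BoxerCalegariGeePilloni2025, Lemma 10.4.1 proof p. 146 (type B[C₂]), Rem. 10.4.2] -/
theorem quadraticImprimitiveSurfaces_of_wreathItems (h₁ : Summit.Langlands.Langlands.Theses.AbelianSurfaceSerre.SerreGSp4WreathFixed) (h₂ : Summit.Langlands.Langlands.Theses.AbelianSurfaceSerre.WreathReductionFixed) : Summit.Langlands.Langlands.Theses.AbelianSurfaceSerre.QuadraticImprimitiveSurfaces :=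
  h₂ h₁

/-- Calibration: the item `WreathReductionFixed` (stmt-Langlands-18078) unfolds to the implication
`SerreGSp4WreathFixed → QuadraticImprimitiveSurfaces` between the route decls (definitional).
[folklore] -/
theorem wreathReductionFixed_iff_imp :
    Summit.Langlands.Langlands.Theses.AbelianSurfaceSerre.WreathReductionFixed ↔
      (Summit.Langlands.Langlands.Theses.AbelianSurfaceSerre.SerreGSp4WreathFixed →
        Summit.Langlands.Langlands.Theses.AbelianSurfaceSerre.QuadraticImprimitiveSurfaces) :=
  Iff.rfl

/-- Calibration: the item `WreathReductionFixed` (stmt-Langlands-18078) IS, definitionally, the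
accepted named fact
`Literature.NumberTheory.DiophantineGeometry.bcgp_serreWreathFixedSimilitude_implies_quadraticImprimitiveSurfacesModular`
(BCGP 2025 Lemma 10.4.1 at the wreath residues with the similitude corrected; p153517) — so a proof
of either is a proof of the other (`.mp` / `.mpr`).
[cite: BoxerCalegariGeePilloni2025, Lemma 10.4.1 proof p. 146 (type B[C₂]), Rem. 10.4.2, Thm 10.2.1] -/
theorem wreathReductionFixed_iff_namedFact :
    Summit.Langlands.Langlands.Theses.AbelianSurfaceSerre.WreathReductionFixed ↔
      Literature.NumberTheory.DiophantineGeometry.bcgp_serreWreathFixedSimilitude_implies_quadraticImprimitiveSurfacesModular :=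
  Iff.rfl

/-- Calibration: the item `WreathReductionFixed` follows from the OLDER recorded named fact
`bcgp_serreWreath_implies_quadraticImprimitiveSurfacesModular` (the `∃ μ` bracket, formally
STRONGER — it over-claims against the source, see the module docstring of
`Literature/NumberTheory/DiophantineGeometry/BcgpSerreWreathFixedSimilitudeImprimitiveSurfaces.lean`)
through the accepted audit theorem `…FixedSimilitude…_of_serreWreath`.  Conditional on that fact;
recorded only to tie the two generations of the reduction together.
[cite: BoxerCalegariGeePilloni2025, Lemma 10.4.1 proof p. 146 (type B[C₂]), Rem. 10.4.2] -/
theorem wreathReductionFixed_of_serreWreath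
    (h : Literature.NumberTheory.DiophantineGeometry.bcgp_serreWreath_implies_quadraticImprimitiveSurfacesModular) :
    Summit.Langlands.Langlands.Theses.AbelianSurfaceSerre.WreathReductionFixed :=
  wreathReductionFixed_iff_namedFact.mpr
    (Literature.NumberTheory.DiophantineGeometry.bcgp_serreWreathFixedSimilitude_implies_quadraticImprimitiveSurfacesModular_of_serreWreath'
      h)

end Summit.Langlands.Langlands.Cruxes.QuadraticImprimitiveSurfaces.Sketch
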